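import Summits.Ventures.YMGap.RobustBall.StarDoorZdW
import Summits.Ventures.YMGap.RobustBall.BallClosure
import Summits.Ventures.YMGap.RobustBall.LocalSourceScreeningStar
import Literature.Probability.LatticeModels.DobrushinShlosmanWeightedGibbsPair
import HarnessLib

/-!
# Venture YMGap, track ROBUST-BALL (Y2) — LOCAL SOURCES ARE SCREENED THROUGH THE WEIGHTED STAR DOOR (tier 2):
# sources of infinite range, members of infinite range, arbitrary-range window arrays

HONEST FRAMING. WHAT THIS IS: a venture file (cell `pub-ymgap`, track Y2 ROBUST-BALL, seat rb-p1, theorems only).  The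
tier-2 twin of `LocalSourceScreeningStar.lean`: the member is a LINK-SUMMABLE potential `W` (continuous own-link terms,
summable link majorant; rb-p1's tier-2 specification `perturbedYMS (fundamentalRep (Fin N)) (N β) W`, no support family, no
range) whose specification has ds-2's WEIGHTED star window bound `StarWindowBoundZdW … t ρ reach` (`StarDoorZdW.lean`:
global window contraction of the star kernels, weighted received sums `Σ' K e^{t·reach} ≤ ρ < 1`); the source is ANY
link-summable `V` (continuous own-link terms) whose terms read only the links of a finite set `S` — any strength.

THE THEOREM (`abs_integral_sub_integral_le_of_source_starW`).  For every DLR state `μ` of `W`, EVERY DLR state `ν` of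
`W + V` and every bounded measurable `f` reading `Δ` with Frobenius-Lipschitz vector `δ`:

  `|∫ f dμ − ∫ f dν| ≤ 2√N · e^{2t} · e^{−t·d(Δ,S)} · Σ_{y ∈ Δ} δ_y`

(`d` = `setDistEdges`); Lipschitz-cylinder reading `…_cylinder` (`Σ δ = #Λ_F K_F`).  RATE = the door's WEIGHT `t`, the
same rate at which ds-2's `abs_covariance_le_of_starWindowBoundZdW` clusters; the constant sees neither the source's
strength nor its size.  MECHANISM: (§0) on a window the source does not read, the tier-2 kernels of `W + V` and `W`
COINCIDE (`perturbedYMS_add_eq_of_dependsOn_compl`: the two summable energies differ by the source series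
`Σ'_{X ∩ Δ ≠ ∅} V_X`, constant on the fibre `{σ = η off Δ}`; a tilt by a constant is no tilt); (§1) the Literature's
weighted Dobrushin–Shlosman comparison for a Gibbs pair
(`DobrushinShlosman.abs_integral_sub_integral_le_window_weighted_pair_exp`) with ds-2's real two-set profile
`exists_starProfileW … Δ S` (usable stars = those avoiding `S`).  The door is discharged for the members of the tier-2
gauge ball by ds-2's chart files (robust weighted star door); this file is generic in the door.
WHAT THIS IS NOT: a one-sided comparison rate; no linear response in the source strength; nothing about uniqueness for
`W + V`; lattice strong coupling only, nothing about the continuum limit or a Clay-sense mass gap.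

References (mechanism): R. L. Dobrushin, S. B. Shlosman (1985), Thm. 1; H. Föllmer, LNM 1362 (1988), Ch. I (2.8), (2.10),
Cor. (2.14); H.-O. Georgii (2011), Remark 8.26.
-/

noncomputable section

open MeasureTheory ProbabilityTheory Function Finset Real
open scoped NNReal
open Literature.Probability.LatticeModels
open Literature.Probability.LatticeModels.DobrushinMetric (IsLipBound)
open Literature.MathematicalPhysics.QuantumLattice
open Literature.MathematicalPhysics.QuantumFieldTheory hiding ZdEdge Site
open Summit.Ventures.YMGap.DSWindowZd

namespace Summit.Ventures.YMGap.RobustBall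

variable {d N : ℕ}

/-! ## §0 The tier-2 kernels of `W + V` and `W` coincide on every window the source does not read -/

section KernelEquality

variable {G : Type*} [Group G] [TopologicalSpace G] [IsTopologicalGroup G] [CompactSpace G]
  [MeasurableSpace G] [BorelSpace G] [SecondCountableTopology G] (ρ : G →* Matrix (Fin N) (Fin N) ℂ)

/-- **The tier-2 kernels of `W + V` and of `W` COINCIDE on a window the source does not read.**  For link-summable
potentials `W`, `V` with continuous terms such that every term of `V` does not depend on the links of `Δ`, the
finite-volume kernels in `Δ` of `β S_W + W + V` and `β S_W + W` (summable energies `perturbedEnergyS`) are EQUAL for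
every boundary condition: the energies differ by the source series `Σ'_{X ∩ Δ ≠ ∅} V_X`, constant on the fibre
`{σ = η off Δ}` carrying the kernel, and a tilt by a constant is no tilt. -/
theorem perturbedYMS_add_eq_of_dependsOn_compl (hρ : Continuous ρ) (β : ℝ) {W V : Potential (ZdEdge d) G}
    {BW BV : Finset (ZdEdge d) → ℝ} (hW : IsLinkSummable W BW) (hV : IsLinkSummable V BV)
    (hVc : ∀ X, Continuous (V X)) (Δ : Finset (ZdEdge d))
    (hVoff : ∀ X, DependsOn (V X) ((↑Δ : Set (ZdEdge d))ᶜ)) (η : LGConfig d G) :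
    perturbedYMS ρ β (W + V) Δ η = perturbedYMS ρ β W Δ η := by
  classical
  haveI : Nonempty (LGConfig d G) := ⟨fun _ => 1⟩
  -- the source series in the volume `Δ`
  set HV : LGConfig d G → ℝ := fun U => ∑' X : Finset (ZdEdge d), (if (X ∩ Δ).Nonempty then V X U else 0)
    with hHV
  -- the two energies differ by `HV`
  have hE : perturbedEnergyS ρ β (W + V) Δ = fun U => perturbedEnergyS ρ β W Δ U - HV U := by
    funext U
    have hsplit : (∑' X : Finset (ZdEdge d), (if (X ∩ Δ).Nonempty then (W + V) X U else 0)) =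
        (∑' X : Finset (ZdEdge d), (if (X ∩ Δ).Nonempty then W X U else 0)) +
          ∑' X : Finset (ZdEdge d), (if (X ∩ Δ).Nonempty then V X U else 0) := by
      refine (tsum_congr fun X => ?_).trans ((hW.summable_term Δ U).tsum_add (hV.summable_term Δ U))
      split_ifs <;> simp [Pi.add_apply]
    simp only [perturbedEnergyS, hHV]
    rw [hsplit]
    ring
  -- `HV` is continuous (hence measurable): `HV = -β S_Δ - perturbedEnergyS ρ β V Δ`
  have hHVm : Measurable HV := by
    have h1 : HV = fun U => -β * wilsonBoundaryAction ρ Δ U - perturbedEnergyS ρ β V Δ U := by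
      funext U; simp only [perturbedEnergyS, hHV]; ring
    rw [h1]
    exact ((continuous_const.mul (continuous_wilsonBoundaryAction ρ hρ Δ)).sub
      (continuous_perturbedEnergyS ρ hρ β hV hVc Δ)).measurable
  -- `HV` is constant on the fibre `{glueWith Δ ζ η}`
  have hconst : ∀ ζ : ↥Δ → G, HV (glueWith Δ ζ η) = HV η := fun ζ => by
    simp only [hHV]
    refine tsum_congr fun X => ?_
    split_ifs with hX
    · exact hVoff X fun e he => glueWith_apply_not_mem Δ ζ η fun heΔ => he (Finset.mem_coe.2 heΔ)
    · rfl
  unfold perturbedYMS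
  rw [hE]
  have hae : (fun U => perturbedEnergyS ρ β W Δ U - HV U)
      =ᵐ[(Measure.pi fun _ : ↥Δ => haarProbability G).map (glueWith Δ · η)]
      fun U => perturbedEnergyS ρ β W Δ U + (-HV η) := by
    have hset : MeasurableSet {U : LGConfig d G | HV U = HV η} := hHVm (measurableSet_singleton _)
    have h0 : ∀ᵐ U ∂(Measure.pi fun _ : ↥Δ => haarProbability G).map (glueWith Δ · η), HV U = HV η :=
      (ae_map_iff (measurable_glueWith Δ η).aemeasurable hset).2 (ae_of_all _ hconst)
    filter_upwards [h0] with U hU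
    rw [hU]
    ring
  rw [tilted_congr hae, tilted_add_const_eq']

end KernelEquality

/-! ## §1 Screening of a local source through the weighted star door -/

/-- **LOCAL SOURCES ARE SCREENED THROUGH THE WEIGHTED STAR DOOR (tier 2).**  Member: a link-summable potential `W` on
`ℤ^d` with continuous own-link terms whose tier-2 specification `perturbedYMS (fundamentalRep (Fin N)) (N β) W` has a
weighted star window bound with rate `t ≥ 0`, received sum `0 ≤ ρ < 1` and a reach dominating the sup-distance from the
star.  Source: a link-summable `V` with continuous own-link terms reading only the links of the finite set `S` — ANY
strength.  Then every DLR state `μ` of `W` and EVERY DLR state `ν` of `W + V` satisfy, for every bounded measurable `f`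
reading `Δ` with Frobenius-Lipschitz vector `δ`:
`|∫ f dμ − ∫ f dν| ≤ 2√N · e^{2t} · e^{−t·d(Δ,S)} · Σ_{y ∈ Δ} δ y`
(Literature `DobrushinShlosman.abs_integral_sub_integral_le_window_weighted_pair_exp`, usable stars = those avoiding
`S`, where the kernels coincide by `perturbedYMS_add_eq_of_dependsOn_compl`; ds-2's profile `exists_starProfileW … Δ S`). -/
theorem abs_integral_sub_integral_le_of_source_starW {β t ρ : ℝ} {W : Potential (ZdEdge d) (SUN N)}
    {Bs : Finset (ZdEdge d) → ℝ} (hWs : IsLinkSummable W Bs) (hWc : ∀ X, Continuous (W X))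
    (hWdep : ∀ X, DependsOn (W X) (↑X : Set (ZdEdge d))) (ht : 0 ≤ t) (hρ0 : 0 ≤ ρ) (hρ1 : ρ < 1)
    {reach : Site d → ZdEdge d → ℝ} (hreach0 : ∀ s y, 0 ≤ reach s y)
    (hreach : ∀ (s : Site d), ∀ x ∈ vertexStarZd s, ∀ y : ZdEdge d, ‖x.1 - y.1‖ ≤ reach s y)
    (h : StarWindowBoundZdW d N (perturbedYMS (d := d) (fundamentalRep (Fin N)) (N * β) W) t ρ reach
      suFrobDist)
    {V : Potential (ZdEdge d) (SUN N)} {BV : Finset (ZdEdge d) → ℝ} (hVs : IsLinkSummable V BV)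
    (hVc : ∀ X, Continuous (V X)) (hVdep : ∀ X, DependsOn (V X) (↑X : Set (ZdEdge d)))
    {S : Finset (ZdEdge d)} (hVS : ∀ X, DependsOn (V X) (↑S : Set (ZdEdge d)))
    {μ ν : Measure (LGConfig d (SUN N))}
    (hμ : μ ∈ perturbedGibbsMeasuresS (d := d) (fundamentalRep (Fin N)) (N * β) W)
    (hν : ν ∈ perturbedGibbsMeasuresS (d := d) (fundamentalRep (Fin N)) (N * β) (W + V))
    {f : LGConfig d (SUN N) → ℝ} (hfm : Measurable f) {Bf : ℝ} (hBf : ∀ σ, |f σ| ≤ Bf)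
    {Δ : Finset (ZdEdge d)} (hfdep : DependsOn f (↑Δ : Set (ZdEdge d)))
    {δ : ZdEdge d → ℝ} (hδ : IsLipBound suFrobDist f δ) :
    |(∫ σ, f σ ∂μ) - ∫ σ, f σ ∂ν| ≤
      2 * Real.sqrt N * Real.exp (2 * t) * Real.exp (-(t * setDistEdges Δ S)) * ∑ y ∈ Δ, δ y := by
  classical
  haveI : SecondCountableTopology (Matrix (Fin N) (Fin N) ℂ) :=
    inferInstanceAs (SecondCountableTopology (Fin N → Fin N → ℂ))
  haveI : SecondCountableTopology (SUN N) := Topology.IsEmbedding.subtypeVal.secondCountableTopology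
  have hWVs : IsLinkSummable (W + V) (Bs + BV) := hWs.add hVs
  have hWVc : ∀ X, Continuous ((W + V) X) := fun X => (hWc X).add (hVc X)
  have hWVdep : ∀ X, DependsOn ((W + V) X) (↑X : Set (ZdEdge d)) := fun X U U' hUU' => by
    simp only [Pi.add_apply, hWdep X hUU', hVdep X hUU']
  have hγ : IsSpecification (perturbedYMS (d := d) (fundamentalRep (Fin N)) (N * β) W) :=
    isSpecification_perturbedYMS _ (continuous_fundamentalRep (Fin N)) _ hWs hWc hWdep
  have hγ' : IsSpecification (perturbedYMS (d := d) (fundamentalRep (Fin N)) (N * β) (W + V)) :=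
    isSpecification_perturbedYMS _ (continuous_fundamentalRep (Fin N)) _ hWVs hWVc hWVdep
  have hμ' : IsGibbsMeasure (perturbedYMS (d := d) (fundamentalRep (Fin N)) (N * β) W) μ := hμ
  have hν' : IsGibbsMeasure (perturbedYMS (d := d) (fundamentalRep (Fin N)) (N * β) (W + V)) ν := hν
  -- the kernels of `W + V` and `W` agree on every star avoiding `S`
  have hagree : ∀ c : ZdEdge d, (∀ z ∈ starWinZd c, z ∉ S) → ∀ (σ : LGConfig d (SUN N))
      ⦃g : LGConfig d (SUN N) → ℝ⦄, Measurable g → (∃ B, ∀ τ, |g τ| ≤ B) →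
      ∫ τ, g τ ∂(perturbedYMS (d := d) (fundamentalRep (Fin N)) (N * β) (W + V) (starWinZd c) σ) =
        ∫ τ, g τ ∂(perturbedYMS (d := d) (fundamentalRep (Fin N)) (N * β) W (starWinZd c) σ) := by
    intro c hc σ g _ _
    have hoff : ∀ A, DependsOn (V A) ((↑(starWinZd c) : Set (ZdEdge d))ᶜ) := fun A =>
      (hVS A).mono fun e heS heW => hc e (Finset.mem_coe.1 heW) (Finset.mem_coe.1 heS)
    rw [perturbedYMS_add_eq_of_dependsOn_compl (fundamentalRep (Fin N)) (continuous_fundamentalRep (Fin N)) (N * β)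
      hWs hVs hVc (starWinZd c) hoff σ]
  obtain ⟨K, hK0, hKs, hcontract, hsum⟩ := h
  have hR₀ : (0 : ℝ) ≤ 2 * Real.sqrt N := by positivity
  obtain ⟨Λ, ρf, hΔΛ, hout, hunc, hlip, hm⟩ := exists_starProfileW reach hreach K Δ S
  have key := DobrushinShlosman.abs_integral_sub_integral_le_window_weighted_pair_exp hγ hγ' suFrobDist_nonneg
    suFrobDist_le hR₀ suFrobDist_self (win := starWinZd) (K := fun c => K c.1) (fun c y x => hK0 _ _ _) hcontract ht
    (d := fun c y _ => reach c.1 y) (fun c y _ => hreach0 _ _) (fun c x => hKs c.1 x) hρ0 hρ1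
    (fun c x hx => hsum c.1 x hx) hμ' hν' Λ (fun c => ∀ z ∈ starWinZd c, z ∉ S) hagree hfm hBf hfdep hδ hΔΛ ρf
    hout hunc hlip hm
  refine key.trans (le_of_eq ?_)
  have : Real.exp (-(t * (setDistEdges Δ S - 2))) = Real.exp (2 * t) * Real.exp (-(t * setDistEdges Δ S)) := by
    rw [← Real.exp_add]; congr 1; ring
  rw [this]; ring

/-- **Lipschitz-cylinder reading** (`Σ δ = #Λ_F · K_F`): for every Lipschitz cylinder `F` on the links `Λ` with constant `K_F`,
`|∫ F dμ − ∫ F dν| ≤ 2√N · e^{2t} · e^{−t·d(Λ,S)} · #Λ · K_F`. -/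
theorem abs_integral_sub_integral_le_of_source_starW_cylinder {β t ρ : ℝ} {W : Potential (ZdEdge d) (SUN N)}
    {Bs : Finset (ZdEdge d) → ℝ} (hWs : IsLinkSummable W Bs) (hWc : ∀ X, Continuous (W X))
    (hWdep : ∀ X, DependsOn (W X) (↑X : Set (ZdEdge d))) (ht : 0 ≤ t) (hρ0 : 0 ≤ ρ) (hρ1 : ρ < 1)
    {reach : Site d → ZdEdge d → ℝ} (hreach0 : ∀ s y, 0 ≤ reach s y)
    (hreach : ∀ (s : Site d), ∀ x ∈ vertexStarZd s, ∀ y : ZdEdge d, ‖x.1 - y.1‖ ≤ reach s y)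
    (h : StarWindowBoundZdW d N (perturbedYMS (d := d) (fundamentalRep (Fin N)) (N * β) W) t ρ reach
      suFrobDist)
    {V : Potential (ZdEdge d) (SUN N)} {BV : Finset (ZdEdge d) → ℝ} (hVs : IsLinkSummable V BV)
    (hVc : ∀ X, Continuous (V X)) (hVdep : ∀ X, DependsOn (V X) (↑X : Set (ZdEdge d)))
    {S : Finset (ZdEdge d)} (hVS : ∀ X, DependsOn (V X) (↑S : Set (ZdEdge d)))
    {μ ν : Measure (LGConfig d (SUN N))}
    (hμ : μ ∈ perturbedGibbsMeasuresS (d := d) (fundamentalRep (Fin N)) (N * β) W)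
    (hν : ν ∈ perturbedGibbsMeasuresS (d := d) (fundamentalRep (Fin N)) (N * β) (W + V))
    {F : LGConfig d (SUN N) → ℝ} {Λ : Finset (ZdEdge d)} {KF : ℝ≥0}
    (hF : IsLipschitzCylinder (fundamentalRep (Fin N)) F Λ KF) :
    |(∫ σ, F σ ∂μ) - ∫ σ, F σ ∂ν| ≤
      2 * Real.sqrt N * Real.exp (2 * t) * Real.exp (-(t * setDistEdges Λ S)) * (Λ.card * KF) := by
  classical
  have hA : ∀ a b : SUN N, dist (suEntries a) (suEntries b) ≤ 1 * suFrobDist a b :=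
    fun a b => by rw [one_mul]; exact dist_suEntries_le_suFrobDist a b
  have key := abs_integral_sub_integral_le_of_source_starW hWs hWc hWdep ht hρ0 hρ1 hreach0 hreach h hVs hVc hVdep hVS
    hμ hν hF.measurable hF.abs_le hF.dependsOn (hF.isLipBound zero_le_one hA)
  have hsum : ∑ y ∈ Λ, (if y ∈ Λ then (1 : ℝ) * (KF : ℝ) else 0) = Λ.card * KF := by
    rw [Finset.sum_ite_of_true (fun y hy => hy), Finset.sum_const, nsmul_eq_mul, one_mul]
  rw [hsum] at key
  exact key

end Summit.Ventures.YMGap.RobustBall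

end
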